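import Summits.CriticalPhenomena.PercolationContinuityZ3.Theorems.Transplant.SkelFrmFromBParamsReachFC
import Summits.CriticalPhenomena.PercolationContinuityZ3.Theorems.Transplant.SkelFrmBParamsReachFC
import Summits.CriticalPhenomena.PercolationContinuityZ3.Theorems.Transplant.SkelNegBParamsReachFC
import Summits.CriticalPhenomena.PercolationContinuityZ3.Theorems.Transplant.SkelFrmQuasi1SlotTypes
import Summits.CriticalPhenomena.PercolationContinuityZ3.Theorems.Transplant.SkelFrm1SlotTypes
import Summits.CriticalPhenomena.PercolationContinuityZ3.Theorems.Transplant.SkelFrmQuasi1ParamsPO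
import Summits.CriticalPhenomena.PercolationContinuityZ3.Theorems.Transplant.SkelFrm1ParamsPO
import Summits.CriticalPhenomena.PercolationContinuityZ3.Theorems.Transplant.SkelFrmQuasi1ParamsLBL
import Summits.CriticalPhenomena.PercolationContinuityZ3.Theorems.Transplant.SkelFrm1ParamsLBL
import Summits.CriticalPhenomena.PercolationContinuityZ3.Theorems.Transplant.SkelFrmFromBParamsKitA
import Summits.CriticalPhenomena.PercolationContinuityZ3.Theorems.Transplant.SkelFrmBParamsKitA
import Summits.CriticalPhenomena.PercolationContinuityZ3.Theorems.Transplant.SkelFrmQuasiBParamsKitS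
import Summits.CriticalPhenomena.PercolationContinuityZ3.Theorems.Transplant.SkelFrmBParamsKitS
import Summits.CriticalPhenomena.PercolationContinuityZ3.Theorems.Transplant.SkelFrmQuasi1ParamsLF
import Summits.CriticalPhenomena.PercolationContinuityZ3.Theorems.Transplant.SkelFrm1ParamsLF
import Summits.CriticalPhenomena.PercolationContinuityZ3.Theorems.Transplant.SkelFrmFrom1ParamsLO
import Summits.CriticalPhenomena.PercolationContinuityZ3.Theorems.Transplant.SkelFrm1ParamsLO
import Summits.CriticalPhenomena.PercolationContinuityZ3.Theorems.Transplant.SkelFrmQuasiBParamsLF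
import Summits.CriticalPhenomena.PercolationContinuityZ3.Theorems.Transplant.SkelFrmBParamsLF
import Summits.CriticalPhenomena.PercolationContinuityZ3.Theorems.Transplant.SkelFrmQuasiBParamsFineSize
import Summits.CriticalPhenomena.PercolationContinuityZ3.Theorems.Transplant.SkelFrmBParamsFineSize
import Summits.CriticalPhenomena.PercolationContinuityZ3.Theorems.Transplant.SkelFrmQuasiBParamsLO
import Summits.CriticalPhenomena.PercolationContinuityZ3.Theorems.Transplant.SkelFrmBParamsLO
import Summits.CriticalPhenomena.PercolationContinuityZ3.Theorems.Transplant.SkelFrmFromBParamsB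
import Summits.CriticalPhenomena.PercolationContinuityZ3.Theorems.Transplant.SkelFrmBParamsB
import Summits.CriticalPhenomena.PercolationContinuityZ3.Theorems.Transplant.SkelFrmFromBParamsSlotsR
import Summits.CriticalPhenomena.PercolationContinuityZ3.Theorems.Transplant.SkelFrmBParamsSlotsR
import Summits.CriticalPhenomena.PercolationContinuityZ3.Theorems.Transplant.SkelFrmQuasiBParamsSlotsRS
import Summits.CriticalPhenomena.PercolationContinuityZ3.Theorems.Transplant.SkelFrmBParamsSlotsRS
import Summits.CriticalPhenomena.PercolationContinuityZ3.Theorems.Transplant.SkelFrmQuasiBParamsSlots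
import Summits.CriticalPhenomena.PercolationContinuityZ3.Theorems.Transplant.SkelFrmBParamsSlots
import Summits.CriticalPhenomena.PercolationContinuityZ3.Theorems.Transplant.SkelFrmFromBParamsSched
import Summits.CriticalPhenomena.PercolationContinuityZ3.Theorems.Transplant.SkelFrmBParamsSched
import Summits.CriticalPhenomena.PercolationContinuityZ3.Theorems.Transplant.SkelNegBParamsSlotsT
import Summits.CriticalPhenomena.PercolationContinuityZ3.Theorems.Transplant.PlanarSkeletonFrmQuasiDefs
import Summits.CriticalPhenomena.PercolationContinuityZ3.Theorems.Transplant.PlanarSkeletonFrmDefs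
import Summits.CriticalPhenomena.PercolationContinuityZ3.Theorems.Transplant.SkelPhiStepIDataNS
import Summits.CriticalPhenomena.PercolationContinuityZ3.Theorems.Transplant.SkelFrmQuasiBParamsKitSN
import HarnessLib
import Summits.CriticalPhenomena.PercolationContinuityZ3.Theorems.Transplant.SkelFrmBParamsSlotsT
/-!
# GEN-Q PORT (WAVE-Q table v0.8 section 2, row G076, U-level L11; captain R-6/R-7 2026-08-27: carrier token swap `PlanarSkeletonFrmFrom ↦ PlanarSkeletonFrmQuasi`)
# of the tree module «Transplant/SkelFrmFromBParamsSlotsT» (sha256 c3948d5c9c87c99d…) onto the quasi-step carrier `PlanarSkeletonFrmQuasi` (p507026): «SkelFrmQuasiBParamsSlotsT»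

ORIGINAL TITLE: N2 (frames-only node `SamePDropOfSkeletonFrmFrom₁`, OPEN) params column over `PlanarSkeletonFrm` — (ζ″) ledger, shape (B′) of record ((R-14)):

builds on p205010 (kernel theorem, internal audit signed; external expert review pending) — nothing in this file uses p205010; NOTHING is claimed about any open node
((N3-b), the end state).  Lane `prim-bschramm`, seat `prim-bschramm-p3` (gen 30; design owner; tool = captain gen-1 g4's port_genq.py R-14 --cone + p3-g30 slot-value patch T1).  Helper file (`--supports stmt-CriticalPhenomena-4575 --as helper`).
PORT RULES (U-wave r1–r4 re-used, GEN-Q hunk classes of p3-g29 #6136): declaration order, names and proof texts are those of «SkelFrmFromBParamsSlotsT», byte-identical except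
(i) the carrier token `PlanarSkeletonFrmFrom ↦ PlanarSkeletonFrmQuasi` in binders, `namespace`/`end` lines and qualified names (module names `SkelFrmFrom… ↦ SkelFrmQuasi…`
in imports of already-ported rows); (ii) `Φ.step ↦ Φ.qstep` with the called Steps lemma replaced by its `…Q`/`_q` twin and the cost `Φ.M` threaded (none in this file unless
listed below); (iii) `Φ.cyl_connected ↦ Φ.cyl_reach` readers (none unless listed); (iv) graph-ball radii / window floors ×`Φ.M` (none unless listed); (v) L-KitS-1 (design-owner ruling 2026-08-27, p5-g28's located item): the kit column's
N-parametrised data of «SkelFrmQuasiBParamsKitSN» (hp-8 g62) at `N := KS.NQ Φ := 13·max Φ.M 1` replace G011's N = 13 data — IN THIS FILE `KS.RA' κ Φ t p D mk ↦ KS.RAN' κ Φ (KS.NQ Φ) t p D mk`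
(the comparison radius), nothing else.  Carrier-free
residents stay imported/exported from the original «SkelFrmBParamsSlotsT» exactly as in the FrmFrom port.  Docstrings and citations are the original's.

-/

noncomputable section

open scoped Classical

namespace Summit.CriticalPhenomena.PercolationContinuityZ3.Theorems.Transplant

namespace PlanarSkeletonFrmQuasi

/-! ## §0 The zero residual -/

-- GEN-Q (R-2, captain 2026-08-27): `PlanarSkeletonFrmFrom.Neg.FSlot.zero` is not in the used cone of the node top — not ported.

-- GEN-Q (R-2, captain 2026-08-27): `PlanarSkeletonFrmFrom.Neg.FSlot.zero_at` is not in the used cone of the node top — not ported.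

namespace NegB

namespace KS

open MeasureTheory Literature.Probability.Percolation Literature.Probability.LatticeModels SimpleGraph
open SkelConc (Consts)
open Skelφ (oriφ trφ)
open Skelφ.StepI (DataN OutO)
open Neg

/-! ## §1 The box slot value -/

/-- **THE BOX FLOOR OF RECORD** (kit index slot `mk`, residual FUNCTION slot `gx`): `max {4K(RA'+2), 22000·(RA'+2), 16(n_b+ℓ_b+|h_b|), gx κ Φ t p D}`. [this work] -/
def gT  (mk : ℕ) (gx : Neg.FSlot) : Neg.FSlot := fun κ _ _ _ _ _ Φ t p D =>
  max (max (max (4 * Neg.K κ * (RAN' κ Φ (NQ Φ) t p D mk + 2)) (22000 * (RAN' κ Φ (NQ Φ) t p D mk + 2))) (16 * (nBR κ Φ t p D mk + ℓBR κ Φ t p D mk + (hBR κ Φ t p D mk).natAbs)))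
    (gx κ Φ t p D)

section Box

/-- `gT` at `(κ, Φ, t, p, D)` (by `rfl`). [folklore] -/
theorem gT_at (κ : Consts) {V : Type} [DecidableEq V] [Countable V] {G : SimpleGraph V} [G.LocallyFinite] (Φ : PlanarSkeletonFrmQuasi G) (t : V) (p : unitInterval) (D : Skelφ.StepI.DataNS V) (mk : ℕ) (gx : Neg.FSlot) : gT mk gx κ Φ t p D =
    max (max (max (4 * Neg.K κ * (RAN' κ Φ (NQ Φ) t p D mk + 2)) (22000 * (RAN' κ Φ (NQ Φ) t p D mk + 2))) (16 * (nBR κ Φ t p D mk + ℓBR κ Φ t p D mk + (hBR κ Φ t p D mk).natAbs)))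
      (gx κ Φ t p D) := rfl

/-- The four floors inside `gT`. [folklore] -/
theorem gT_floors (κ : Consts) {V : Type} [DecidableEq V] [Countable V] {G : SimpleGraph V} [G.LocallyFinite] (Φ : PlanarSkeletonFrmQuasi G) (t : V) (p : unitInterval) (D : Skelφ.StepI.DataNS V) (mk : ℕ) (gx : Neg.FSlot) : 4 * Neg.K κ * (RAN' κ Φ (NQ Φ) t p D mk + 2) ≤ gT mk gx κ Φ t p D ∧ 22000 * (RAN' κ Φ (NQ Φ) t p D mk + 2) ≤ gT mk gx κ Φ t p D ∧
    16 * (nBR κ Φ t p D mk + ℓBR κ Φ t p D mk + (hBR κ Φ t p D mk).natAbs) ≤ gT mk gx κ Φ t p D ∧ gx κ Φ t p D ≤ gT mk gx κ Φ t p D := by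
  refine ⟨?_, ?_, ?_, le_max_right _ _⟩ <;> rw [gT_at] <;> omega

/-- **THE LONG BOX's FLOORS AT `g := gT`**. [folklore] -/
theorem ML_floorsT (κ : Consts) {V : Type} [DecidableEq V] [Countable V] {G : SimpleGraph V} [G.LocallyFinite] (Φ : PlanarSkeletonFrmQuasi G) (t : V) (p : unitInterval) (D : Skelφ.StepI.DataNS V) (mk : ℕ) (gx : Neg.FSlot) : 4 * Neg.K κ * (RAN' κ Φ (NQ Φ) t p D mk + 2) ≤ ML κ Φ t p D (gT mk gx κ Φ t p D) ∧ 22000 * (RAN' κ Φ (NQ Φ) t p D mk + 2) ≤ ML κ Φ t p D (gT mk gx κ Φ t p D) ∧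
    16 * (nBR κ Φ t p D mk + ℓBR κ Φ t p D mk + (hBR κ Φ t p D mk).natAbs) ≤ ML κ Φ t p D (gT mk gx κ Φ t p D) ∧
    gx κ Φ t p D ≤ ML κ Φ t p D (gT mk gx κ Φ t p D) ∧ 4 * Neg.K κ * RAN' κ Φ (NQ Φ) t p D mk + 2 ≤ ML κ Φ t p D (gT mk gx κ Φ t p D) ∧
    RAN' κ Φ (NQ Φ) t p D mk + 2 ≤ ML κ Φ t p D (gT mk gx κ Φ t p D) := by
  have hg := (ML_le_ML κ Φ t p D (gT mk gx κ Φ t p D)).2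
  obtain ⟨h1, h2, h3, h4⟩ := gT_floors κ Φ t p D mk gx
  have hK := (Neg.forty_le_K κ).1
  refine ⟨h1.trans hg, h2.trans hg, h3.trans hg, h4.trans hg, ?_, ?_⟩
  · have : 4 * Neg.K κ * RAN' κ Φ (NQ Φ) t p D mk + 2 ≤ 4 * Neg.K κ * (RAN' κ Φ (NQ Φ) t p D mk + 2) := by nlinarith
    exact this.trans (h1.trans hg)
  · have : RAN' κ Φ (NQ Φ) t p D mk + 2 ≤ 22000 * (RAN' κ Φ (NQ Φ) t p D mk + 2) := by omega
    exact this.trans (h2.trans hg)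

-- GEN-Q (R-2, captain 2026-08-27): `PlanarSkeletonFrmFrom.NegB.KS.ML_floorT_int` is not in the used cone of the node top — not ported.

end Box

/-! ## §2 The width slot value -/

/-- **THE WIDTH FLOOR OF RECORD** (residual FUNCTION slot `fx`): `max {K(RA'+2), 2000·(RA'+2), D.k + RA' + pgScale n_b h_b (3ℓ_b) + 1, fx κ Φ t p D}`. [this work] -/
def fT  (mk : ℕ) (fx : Neg.FSlot) : Neg.FSlot := fun κ _ _ _ _ _ Φ t p D =>
  max (max (max (Neg.K κ * (RAN' κ Φ (NQ Φ) t p D mk + 2)) (2000 * (RAN' κ Φ (NQ Φ) t p D mk + 2)))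
    (D.k + RAN' κ Φ (NQ Φ) t p D mk + Skelφ.pgScale (nBR κ Φ t p D mk) (hBR κ Φ t p D mk) (3 * ℓBR κ Φ t p D mk) + 1)) (fx κ Φ t p D)

section Width

/-- `fT` at `(κ, Φ, t, p, D)` (by `rfl`). [folklore] -/
theorem fT_at (κ : Consts) {V : Type} [DecidableEq V] [Countable V] {G : SimpleGraph V} [G.LocallyFinite] (Φ : PlanarSkeletonFrmQuasi G) (t : V) (p : unitInterval) (D : Skelφ.StepI.DataNS V) (mk : ℕ) (fx : Neg.FSlot) : fT mk fx κ Φ t p D =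
    max (max (max (Neg.K κ * (RAN' κ Φ (NQ Φ) t p D mk + 2)) (2000 * (RAN' κ Φ (NQ Φ) t p D mk + 2)))
      (D.k + RAN' κ Φ (NQ Φ) t p D mk + Skelφ.pgScale (nBR κ Φ t p D mk) (hBR κ Φ t p D mk) (3 * ℓBR κ Φ t p D mk) + 1)) (fx κ Φ t p D) := rfl

/-- The four floors inside `fT`. [folklore] -/
theorem fT_floors (κ : Consts) {V : Type} [DecidableEq V] [Countable V] {G : SimpleGraph V} [G.LocallyFinite] (Φ : PlanarSkeletonFrmQuasi G) (t : V) (p : unitInterval) (D : Skelφ.StepI.DataNS V) (mk : ℕ) (fx : Neg.FSlot) : Neg.K κ * (RAN' κ Φ (NQ Φ) t p D mk + 2) ≤ fT mk fx κ Φ t p D ∧ 2000 * (RAN' κ Φ (NQ Φ) t p D mk + 2) ≤ fT mk fx κ Φ t p D ∧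
    D.k + RAN' κ Φ (NQ Φ) t p D mk + Skelφ.pgScale (nBR κ Φ t p D mk) (hBR κ Φ t p D mk) (3 * ℓBR κ Φ t p D mk) + 1 ≤ fT mk fx κ Φ t p D ∧ fx κ Φ t p D ≤ fT mk fx κ Φ t p D := by
  refine ⟨?_, ?_, ?_, le_max_right _ _⟩ <;> rw [fT_at] <;> omega

-- GEN-Q (R-2, captain 2026-08-27): `PlanarSkeletonFrmFrom.NegB.KS.nL_floorsT` is not in the used cone of the node top — not ported.

-- GEN-Q (R-2, captain 2026-08-27): `PlanarSkeletonFrmFrom.NegB.KS.nL_floorT_int` is not in the used cone of the node top — not ported.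

end Width

/-! ## §3 Cells, layer and the corridor floors at the values -/

section AtValues

-- GEN-Q (R-2, captain 2026-08-27): `PlanarSkeletonFrmFrom.NegB.KS.cells_geT` is not in the used cone of the node top — not ported.

-- GEN-Q (R-2, captain 2026-08-27): `PlanarSkeletonFrmFrom.NegB.KS.r_geT` is not in the used cone of the node top — not ported.

-- GEN-Q (R-2, captain 2026-08-27): `PlanarSkeletonFrmFrom.NegB.KS.ℓL_ge_T` is not in the used cone of the node top — not ported.

-- GEN-Q (R-2, captain 2026-08-27): `PlanarSkeletonFrmFrom.NegB.KS.layer_T` is not in the used cone of the node top — not ported.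

-- GEN-Q (R-2, captain 2026-08-27): `PlanarSkeletonFrmFrom.NegB.KS.corridor_floors_T` is not in the used cone of the node top — not ported.

end AtValues

end KS

end NegB

end PlanarSkeletonFrmQuasi

end Summit.CriticalPhenomena.PercolationContinuityZ3.Theorems.Transplant

end
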